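import Literature.NumberTheory.EllipticCurves.PadicLogLatticeIndexProofs
import Literature.NumberTheory.EllipticCurves.LocalTorsionAdditiveReductionPPrimaryProofs
import HarnessLib

/-!
# The `p`-adic logarithm lattice of `E(ℚ_p)`, II: exponent form and the ADDITIVE prime of a global curve —
# `log_ω(E(ℚ_p) ⊗ ℤ_p) = p^{τ − v_p(c_p)} ℤ_p` (Kim–Nakamura 2020 Cor. 2.4 / C.-H. Kim AJM §3.2.3, log side)

`Proofs` file (theorems only), topic `NumberTheory/EllipticCurves`; seat `bsd-potss-kmc` (cell `bsd-potss`),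
generation 14, PART 21b, continuation of `PadicLogLatticeIndexProofs` (the range of `P ↦ L([E : E⁽²⁾] • P)` is
EXACTLY `ℤ_p · (#E(ℚ_p)_tors · p²)`).  Here: the same statements without the bundled homomorphism
(`exists_padicLimitLog_index_nsmul_eq_iff`, `exists_norm_padicLimitLog_index_nsmul_eq`), the count
`#E(ℚ_p)_tors · p^j = [E(ℚ_p) : E⁽²⁾]` (`exists_card_torsion_mul_pow_eq_index`: the prime-to-`p` part of the
local torsion order is that of `c_p · #Ẽ_ns(𝔽_p)`), the exponent form `‖L([E : E⁽²⁾] • P)‖ ≤ p^{−(τ+2)}`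
attained (`τ = v_p #E(ℚ_p)_tors`), and for a globally minimal `W/ℚ` with ADDITIVE reduction at `p`:
`[E(ℚ_p) : E⁽²⁾] = c_p · p²` (`index_formalFiltration_two_of_additive`) and
**`‖L((c_p p²) • P)‖ ≤ p^{−(τ+2)}` for all `P ∈ E(ℚ_p)`, with equality for some `P`**
(`norm_padicLimitLog_tamagawa_nsmul_of_additive`) — i.e. `log_ω(E(ℚ_p) ⊗ ℤ_p) = p^{τ − v_p(c_p)} ℤ_p`, the
Tate dual of Kim's `exp*_ω(H¹(ℚ_p, T_pE)) = c_p · p^{−τ} · ℤ_p`, the local index of Kato's descent at an additive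
prime (Kato 2004 Prop. 14.16 (2); the local step of this cell's `Kato2004.MemberHullInputs.count`; Kim–Nakamura
proof of Thm. 4.5).  No parity hypothesis on `p`; `exp*` itself is not a tree object.

References: C.-H. Kim, K. Nakamura, J. Number Theory 210 (2020) 249–279 = arXiv:1808.07726, Thm. 2.1, Prop. 2.2,
Cor. 2.4 [KimNakamura2020]; C.-H. Kim, Amer. J. Math. 148 (2026) = arXiv:2203.12159, §3.2.3
[Kim2022StructureSelmer]; K. Kato, Astérisque 295 (2004), Prop. 14.16 (2) [Kato2004Asterisque]; J. H. Silverman,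
*AEC* 2nd ed. (2009) VII.2.1, VII.3.1, VII.6.3, Exercise 3.5 [SilvermanAEC2009].
-/

noncomputable section

namespace WeierstrassCurve

open scoped Classical
open Literature.NumberTheory.EllipticCurves

/-! ## §4 The statements without the bundled map; exponents; the additive prime of a global curve -/

section Consequences

variable {p : ℕ} [Fact p.Prime] (W : WeierstrassCurve ℚ_[p]) [hW : W.IsIntegral ℤ_[p]]
  [W.IsElliptic]

/-- **THE BOUND IS ATTAINED:** some `P ∈ E(ℚ_p)` has `‖L([E : E⁽²⁾] • P)‖ = ‖#E(ℚ_p)_tors‖_p · p⁻²`.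
[cite: KimNakamura2020, Cor. 2.4] [cite: SilvermanAEC2009, VII.6.3] -/
theorem exists_norm_padicLimitLog_index_nsmul_eq :
    ∃ P : W.toAffine.Point, ‖W.padicLimitLog ((W.formalFiltration 2).index • P)‖ =
      ‖((Nat.card (AddCommGroup.torsion W.toAffine.Point) : ℚ_[p]) * (p : ℚ_[p]) ^ 2)‖ := by
  obtain ⟨Φ, hΦ⟩ := W.exists_addMonoidHom_padicLimitLog_index_nsmul
  have hmem : ((Nat.card (AddCommGroup.torsion W.toAffine.Point) : ℚ_[p]) * (p : ℚ_[p]) ^ 2)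
      ∈ Φ.range := by
    rw [(W.range_eq_span_and_relIndex_eq hΦ).1, Submodule.mem_toAddSubgroup]
    exact Submodule.mem_span_singleton_self _
  obtain ⟨P, hP⟩ := hmem
  exact ⟨P, by rw [← hΦ, hP]⟩

/-- **THE LOG LATTICE:** `t = L([E : E⁽²⁾] • P)` for some `P ∈ E(ℚ_p)` iff `‖t‖ ≤ ‖#E(ℚ_p)_tors‖_p · p⁻²` —
the image of the (scaled) logarithm is EXACTLY the ball `ℤ_p · (#E(ℚ_p)_tors p²)`.
[cite: KimNakamura2020, Cor. 2.4] [cite: Kim2022StructureSelmer, §3.2.3] [cite: SilvermanAEC2009, VII.6.3] -/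
theorem exists_padicLimitLog_index_nsmul_eq_iff (t : ℚ_[p]) :
    (∃ P : W.toAffine.Point, W.padicLimitLog ((W.formalFiltration 2).index • P) = t) ↔
      ‖t‖ ≤ ‖((Nat.card (AddCommGroup.torsion W.toAffine.Point) : ℚ_[p]) * (p : ℚ_[p]) ^ 2)‖ := by
  obtain ⟨Φ, hΦ⟩ := W.exists_addMonoidHom_padicLimitLog_index_nsmul
  have hc0 : ((Nat.card (AddCommGroup.torsion W.toAffine.Point) : ℚ_[p]) * (p : ℚ_[p]) ^ 2) ≠ 0 :=
    mul_ne_zero (Nat.cast_ne_zero.mpr W.natCard_torsion_padicPoint_ne_zero)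
      (pow_ne_zero _ (Nat.cast_ne_zero.mpr (Fact.out : p.Prime).ne_zero))
  have h : (∃ P : W.toAffine.Point, W.padicLimitLog ((W.formalFiltration 2).index • P) = t) ↔
      t ∈ Φ.range := by
    rw [AddMonoidHom.mem_range]
    exact exists_congr fun P ↦ by rw [hΦ]
  rw [h, (W.range_eq_span_and_relIndex_eq hΦ).1, Submodule.mem_toAddSubgroup,
    mem_span_padicInt_singleton_iff hc0]

/-- **`#E(ℚ_p)_tors · p^j = [E(ℚ_p) : E⁽²⁾]` for some `j`** (namely `p^j = [Φ(E) : Φ(E⁽²⁾)]`): for a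
minimal equation `[E : E⁽²⁾] = c_p · #Ẽ_ns(𝔽_p) · p`, so the prime-to-`p` part of the local torsion order
equals the prime-to-`p` part of `c_p · #Ẽ_ns(𝔽_p)`. [cite: SilvermanAEC2009, VII.2.1, VII.3.1 and VII.6.3] -/
theorem exists_card_torsion_mul_pow_eq_index :
    ∃ j : ℕ, Nat.card (AddCommGroup.torsion W.toAffine.Point) * p ^ j = (W.formalFiltration 2).index := by
  obtain ⟨Φ, hΦ⟩ := W.exists_addMonoidHom_padicLimitLog_index_nsmul
  refine ⟨padicValNat p (((W.formalFiltration 2).map Φ).relIndex Φ.range), ?_⟩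
  rw [← (W.range_eq_span_and_relIndex_eq hΦ).2]
  exact (W.index_formalFiltration_two_eq_card_torsion_mul_relIndex hΦ).symm

/-- The radius as a power of `p`: `‖#E(ℚ_p)_tors · p²‖_p = p^{−(τ + 2)}`, `τ = v_p(#E(ℚ_p)_tors)`. [cite: Koblitz1984, Ch. I §2 (`|p|_p = 1/p`)] [cite: SilvermanAEC2009, VII.6.3] -/
theorem norm_card_torsion_mul_sq :
    ‖((Nat.card (AddCommGroup.torsion W.toAffine.Point) : ℚ_[p]) * (p : ℚ_[p]) ^ 2)‖ =
      ((p : ℝ)⁻¹) ^ (padicValNat p (Nat.card (AddCommGroup.torsion W.toAffine.Point)) + 2) := by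
  have hT0 : (Nat.card (AddCommGroup.torsion W.toAffine.Point) : ℚ_[p]) ≠ 0 :=
    Nat.cast_ne_zero.mpr W.natCard_torsion_padicPoint_ne_zero
  rw [norm_mul, Padic.norm_eq_zpow_neg_valuation hT0, Padic.valuation_natCast, zpow_neg, zpow_natCast,
    norm_natCast_prime_sq (p := p), pow_add, inv_pow, inv_pow]

/-- **EXPONENT FORM: `‖L([E : E⁽²⁾] • P)‖ ≤ p^{−(τ+2)}` for all `P`, with equality for some `P`**
(`τ = v_p #E(ℚ_p)_tors`).  For a MINIMAL equation `[E : E⁽²⁾] = c_p · #Ẽ_ns(𝔽_p) · p`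
(`index_formalFiltration`), so the normalised lattice `log_ω(E(ℚ_p) ⊗ ℤ_p)` is
`p^{τ + 1 − v_p(c_p · #Ẽ_ns(𝔽_p))} ℤ_p`. [cite: KimNakamura2020, Cor. 2.4] [cite: SilvermanAEC2009, VII.6.3] -/
theorem norm_padicLimitLog_index_nsmul_le_pow_and_exists :
    (∀ P : W.toAffine.Point, ‖W.padicLimitLog ((W.formalFiltration 2).index • P)‖ ≤
        ((p : ℝ)⁻¹) ^ (padicValNat p (Nat.card (AddCommGroup.torsion W.toAffine.Point)) + 2)) ∧
      ∃ P : W.toAffine.Point, ‖W.padicLimitLog ((W.formalFiltration 2).index • P)‖ =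
        ((p : ℝ)⁻¹) ^ (padicValNat p (Nat.card (AddCommGroup.torsion W.toAffine.Point)) + 2) := by
  rw [← W.norm_card_torsion_mul_sq]
  exact ⟨W.norm_padicLimitLog_index_nsmul_le, W.exists_norm_padicLimitLog_index_nsmul_eq⟩

end Consequences

section Additive

variable (W : WeierstrassCurve ℚ) [W.IsElliptic] [W.IsGloballyMinimal] (p : ℕ) [Fact p.Prime]

/-- `[E(ℚ_p) : E⁽²⁾(ℚ_p)] = c_p · p²` for a globally minimal `W/ℚ` with ADDITIVE reduction at `p`
(`[E : E₁] = c_p · p`, `index_formalFiltration_one_of_additive`; `[E₁ : E₂] = p`).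
[cite: SilvermanAEC2009, VII.2 Prop. 2.1, IV.3.2 (a), Exercise 3.5] -/
theorem index_formalFiltration_two_of_additive (hng : ¬ W.HasGoodReductionAtPrime p)
    (hnm : ¬ W.HasMultiplicativeReductionAtPrime p) :
    ((W.baseChange ℚ_[p]).formalFiltration 2).index =
      (W.baseChange ℚ_[p]).localTamagawaNumber ℤ_[p] * p ^ 2 := by
  haveI : (W.baseChange ℚ_[p]).IsMinimal ℤ_[p] := isMinimal_map_padic_of_isGloballyMinimal W p
  haveI : (W.baseChange ℚ_[p]).IsElliptic := by rw [baseChange]; infer_instance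
  have h1 := index_formalFiltration_one_of_additive W p hng hnm
  have h2 := (W.baseChange ℚ_[p]).relIndex_formalFiltration_succ (le_refl 1)
  rw [← AddSubgroup.relIndex_mul_index
    ((W.baseChange ℚ_[p]).formalFiltration_antitone (by norm_num : 1 ≤ 2)), h2, h1]
  ring

/-- **THE LOCAL INDEX AT AN ADDITIVE PRIME (Kim–Nakamura Cor. 2.4, log side; C.-H. Kim AJM §3.2.3):**
for a globally minimal `W/ℚ` with additive reduction at `p` and every `P ∈ E(ℚ_p)`,
`‖L((c_p p²) • P)‖ ≤ p^{−(τ+2)}` with EQUALITY for some `P` (`p^τ ∥ #E(ℚ_p)_tors`) — i.e. the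
normalised logarithm lattice is `log_ω(E(ℚ_p) ⊗ ℤ_p) = (c_p p²)⁻¹ · p^{τ+2} ℤ_p = p^{τ − v_p(c_p)} ℤ_p`,
the Tate dual of `exp*_ω(H¹(ℚ_p, T_pE)) = c_p p^{−τ} ℤ_p`.  ANY `p` (no parity hypothesis).
[cite: KimNakamura2020, Thm. 2.1, Prop. 2.2 and Cor. 2.4 (arXiv p. 5)] [cite: Kim2022StructureSelmer, §3.2.3 display before Thm. 3.7]
[cite: SilvermanAEC2009, VII.6.3] -/
theorem norm_padicLimitLog_tamagawa_nsmul_of_additive (hng : ¬ W.HasGoodReductionAtPrime p)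
    (hnm : ¬ W.HasMultiplicativeReductionAtPrime p) :
    (∀ P : (W.baseChange ℚ_[p]).toAffine.Point,
        ‖(W.baseChange ℚ_[p]).padicLimitLog
            (((W.baseChange ℚ_[p]).localTamagawaNumber ℤ_[p] * p ^ 2) • P)‖ ≤
          ((p : ℝ)⁻¹) ^
            (padicValNat p (Nat.card (AddCommGroup.torsion (W.baseChange ℚ_[p]).toAffine.Point)) + 2)) ∧
      ∃ P : (W.baseChange ℚ_[p]).toAffine.Point,
        ‖(W.baseChange ℚ_[p]).padicLimitLog
            (((W.baseChange ℚ_[p]).localTamagawaNumber ℤ_[p] * p ^ 2) • P)‖ =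
          ((p : ℝ)⁻¹) ^
            (padicValNat p (Nat.card (AddCommGroup.torsion (W.baseChange ℚ_[p]).toAffine.Point)) + 2) := by
  haveI : (W.baseChange ℚ_[p]).IsMinimal ℤ_[p] := isMinimal_map_padic_of_isGloballyMinimal W p
  haveI : (W.baseChange ℚ_[p]).IsElliptic := by rw [baseChange]; infer_instance
  rw [← index_formalFiltration_two_of_additive W p hng hnm]
  exact (W.baseChange ℚ_[p]).norm_padicLimitLog_index_nsmul_le_pow_and_exists

end Additive

end WeierstrassCurve

end
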